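import Summits.KontsevichZagierPeriods.KontsevichZagierPeriods.Theorems.RootDecompZetaThreeFrontierGZLadderFourPolarP03

/-! # `RootDecompZetaThreeFrontierGZLadderFourPolarP04` — part 4/12 of the mechanical ≤400-line split of `l4_src.lean` (sha256 5cc5a9ee4c47da9a…)
Source: decomp-kz lens-1 g13 Layer4_v1.lean @897236f9 minus the RungFour prelude block (imported from …RungFourPreludeP14); --supports stmt-KontsevichZagierPeriods-27141.
Split by census-1 g10 `gen/splitlean.py`: scopes re-opened with their `open`/`variable`/`set_option` context; mathematics and declaration order unchanged. -/

set_option linter.dupNamespace false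
noncomputable section
set_option linter.dupNamespace false
set_option linter.unusedVariables false
set_option linter.unusedSectionVars false
set_option linter.unusedSimpArgs false
open Set MeasureTheory MvPolynomial
open Literature.NumberTheory.Transcendental
open Summit.KontsevichZagierPeriods.KontsevichZagierPeriods.Theorems.RootDecompZetaThreeFrontierWordMoves
namespace Summit.KontsevichZagierPeriods.KontsevichZagierPeriods.Cruxes.GZNormalFormWThree.GZLadder.MatchFour
open Summit.KontsevichZagierPeriods.KontsevichZagierPeriods.Cruxes.GZNormalFormWThree.GZLadder.RungFour
open Summit.KontsevichZagierPeriods.KontsevichZagierPeriods.Cruxes.GZNormalFormWThree.GZLadder.WlogFour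

open Set MeasureTheory MvPolynomial in
open Literature.NumberTheory.Transcendental in
open Summit.KontsevichZagierPeriods.KontsevichZagierPeriods.Theorems.RootDecompZetaThreeFrontierWordMoves in
open Summit.KontsevichZagierPeriods.KontsevichZagierPeriods.Cruxes.GZNormalFormWThree.GZLadder.RungThree (congInto_mono congInto_of_mem_closure congInto_of_sub_mem) in
open Summit.KontsevichZagierPeriods.KontsevichZagierPeriods.Cruxes.GZNormalFormWThree.GZLadder.RungFour in
open Summit.KontsevichZagierPeriods.KontsevichZagierPeriods.Cruxes.GZNormalFormWThree.GZLadder.WlogFour in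
/-- a representation whose integrand vanishes on its domain is a relation (rule 1b: `f = f + f`) -/
private theorem of_mem_relations_of_integrand_zero4 {n : ℕ} (z : KZ.IntegralRep n)
    (hz : ∀ x ∈ z.domain, z.integrand x = 0) : KZ.of z ∈ KZ.relations := by
  have h3 : KZ.of z - KZ.of z - KZ.of z ∈ KZ.relations :=
    KZ.integrandAddRel_subset_relations ⟨n, z, z, z, rfl, rfl, fun x hx => by simp [hz x hx], rfl⟩
  rw [show KZ.of z - KZ.of z - KZ.of z = -KZ.of z by abel] at h3
  exact neg_mem_iff.mp h3

/-- one rule-1b split on `Δ₄` (sum form), for an arbitrary target set `S` of generators -/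
theorem of_add_split4 (S : Set KZ.FormalRep) (r r₁ r₂ : KZ.IntegralRep 4) (hd : r.domain = KZ.openOrderedSimplex 4)
    (hd₁ : r₁.domain = KZ.openOrderedSimplex 4) (hd₂ : r₂.domain = KZ.openOrderedSimplex 4)
    (hsplit : ∀ z ∈ KZ.openOrderedSimplex 4, r.integrand z = r₁.integrand z + r₂.integrand z)
    (h₁ : ∃ m ∈ AddSubgroup.closure S, KZ.of r₁ - m ∈ KZ.relations)
    (h₂ : ∃ m ∈ AddSubgroup.closure S, KZ.of r₂ - m ∈ KZ.relations) :
    ∃ m ∈ AddSubgroup.closure S, KZ.of r - m ∈ KZ.relations := by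
  obtain ⟨m₁, hm₁, h₁⟩ := h₁
  obtain ⟨m₂, hm₂, h₂⟩ := h₂
  have h : KZ.of r - KZ.of r₁ - KZ.of r₂ ∈ KZ.relations :=
    KZ.integrandAddRel_subset_relations ⟨4, r, r₁, r₂, by rw [hd, hd₁], by rw [hd₂, hd], fun z hz => by
      rw [Pi.add_apply]; rw [hd] at hz; exact hsplit z hz, rfl⟩
  refine ⟨m₁ + m₂, add_mem hm₁ hm₂, ?_⟩
  have e : KZ.of r - (m₁ + m₂) = (KZ.of r - KZ.of r₁ - KZ.of r₂) + (KZ.of r₁ - m₁) + (KZ.of r₂ - m₂) := by abel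
  rw [e]
  exact add_mem (add_mem h h₁) h₂

/-- **finite sums on `Δ₄` (rule 1b iterated)** — verbatim port of `WordLayer.sum_pack3`. -/
theorem sum_pack4 (S : Set KZ.FormalRep) {ι : Type*} (T : Finset ι) (f : ι → (Fin 4 → ℝ) → ℝ)
    (hsa : ∀ i ∈ T, IsSemialgebraicFunOn ℚ (KZ.openOrderedSimplex 4) (f i))
    (hint : ∀ i ∈ T, IntegrableOn (f i) (KZ.openOrderedSimplex 4))
    (hmem : ∀ i ∈ T, ∀ (r : KZ.IntegralRep 4), r.domain = KZ.openOrderedSimplex 4 →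
      EqOn r.integrand (f i) r.domain → ∃ m ∈ AddSubgroup.closure S, KZ.of r - m ∈ KZ.relations) :
    IsSemialgebraicFunOn ℚ (KZ.openOrderedSimplex 4) (fun z => ∑ i ∈ T, f i z) ∧
    IntegrableOn (fun z => ∑ i ∈ T, f i z) (KZ.openOrderedSimplex 4) ∧
    ∀ (r : KZ.IntegralRep 4), r.domain = KZ.openOrderedSimplex 4 →
      EqOn r.integrand (fun z => ∑ i ∈ T, f i z) r.domain →
      ∃ m ∈ AddSubgroup.closure S, KZ.of r - m ∈ KZ.relations := by
  classical
  induction T using Finset.induction_on with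
  | empty =>
    refine ⟨(isSemialgebraicFunOn_aeval (KZ.isSemialgebraic_openOrderedSimplex 4) (0 : MvPolynomial (Fin 4) ℚ)).congr
      fun z _ => by simp, by simp, fun r hd hi => ⟨0, zero_mem _, ?_⟩⟩
    rw [sub_zero]
    exact of_mem_relations_of_integrand_zero4 r fun z hz => by rw [hi hz]; simp
  | insert a T haT ih =>
    obtain ⟨hsaT, hintT, hmemT⟩ := ih (fun i hi => hsa i (Finset.mem_insert_of_mem hi))
      (fun i hi => hint i (Finset.mem_insert_of_mem hi)) (fun i hi => hmem i (Finset.mem_insert_of_mem hi))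
    have hsa' : IsSemialgebraicFunOn ℚ (KZ.openOrderedSimplex 4) (fun z => ∑ i ∈ insert a T, f i z) :=
      (IsSemialgebraicFunOn.add_holds (hsa a (Finset.mem_insert_self a T)) hsaT).congr fun z _ => by
        simp only [Pi.add_apply, Finset.sum_insert haT]
    have hint' : IntegrableOn (fun z => ∑ i ∈ insert a T, f i z) (KZ.openOrderedSimplex 4) :=
      ((hint a (Finset.mem_insert_self a T)).add hintT).congr_fun
        (fun z _ => by simp only [Pi.add_apply, Finset.sum_insert haT]) (measurableSet_simplex 4)
    refine ⟨hsa', hint', fun r hd hi => ?_⟩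
    refine of_add_split4 S r (repFour (f a) (hsa a (Finset.mem_insert_self a T)) (hint a (Finset.mem_insert_self a T)))
      (repFour _ hsaT hintT) hd rfl rfl (fun z hz => ?_)
      (hmem a (Finset.mem_insert_self a T) _ rfl fun _ _ => rfl) (hmemT _ rfl fun _ _ => rfl)
    rw [hi (by rw [hd]; exact hz)]
    show ∑ i ∈ insert a T, f i z = f a z + ∑ i ∈ T, f i z
    rw [Finset.sum_insert haT]

/-- the scaled gap class `q · gapF4` is `ℚ`-semialgebraic on `Δ₄` -/
theorem gapF4_smul_sa (q : ℚ) (κ : Fin 5 →₀ ℕ) (β₀ β₁ β₂ γ₁ γ₂ γ₃ α₀₂ α₀₃ α₁₃ : ℕ) :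
    IsSemialgebraicFunOn ℚ (KZ.openOrderedSimplex 4) (fun t => (q : ℝ) * gapF4 κ β₀ β₁ β₂ γ₁ γ₂ γ₃ α₀₂ α₀₃ α₁₃ t) := by
  refine (isSemialgebraicFunOn_aeval_div_aeval (KZ.isSemialgebraic_openOrderedSimplex 4)
    (MvPolynomial.C q * ((MvPolynomial.C 1 - MvPolynomial.X 0) ^ κ 0 * (MvPolynomial.X 0 - MvPolynomial.X 1) ^ κ 1 *
      (MvPolynomial.X 1 - MvPolynomial.X 2) ^ κ 2 * (MvPolynomial.X 2 - MvPolynomial.X 3) ^ κ 3 * MvPolynomial.X 3 ^ κ 4))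
    (MvPolynomial.X 0 ^ β₀ * MvPolynomial.X 1 ^ β₁ * MvPolynomial.X 2 ^ β₂ * (MvPolynomial.C 1 - MvPolynomial.X 1) ^ γ₁ *
      (MvPolynomial.C 1 - MvPolynomial.X 2) ^ γ₂ * (MvPolynomial.C 1 - MvPolynomial.X 3) ^ γ₃ *
      (MvPolynomial.X 0 - MvPolynomial.X 2) ^ α₀₂ * (MvPolynomial.X 0 - MvPolynomial.X 3) ^ α₀₃ *
      (MvPolynomial.X 1 - MvPolynomial.X 3) ^ α₁₃) fun t ht => ?_).congr
    fun t ht => ?_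
  · obtain ⟨g0, g1, g2, g3, g4, g5, g6, g7, g8, g9, g10, g11, g12, g13⟩ := gz4_denoms_pos ht
    have : (0:ℝ) < 1 - t 1 := by linarith
    have : (0:ℝ) < 1 - t 2 := by linarith
    have : (0:ℝ) < 1 - t 3 := by linarith
    have : (0:ℝ) < t 0 - t 2 := by linarith
    have : (0:ℝ) < t 0 - t 3 := by linarith
    have : (0:ℝ) < t 1 - t 3 := by linarith
    simp only [map_mul, map_pow, map_sub, MvPolynomial.aeval_X, map_one]
    positivity
  · simp only [map_mul, map_pow, map_sub, MvPolynomial.aeval_X, MvPolynomial.aeval_C, map_one, gapF4, eq_ratCast]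
    ring

/-- **the per-class step is TRIVIAL for the single-monomial cut**: a scaled admissible gap class on `Δ₄` IS a layer datum. -/
theorem gapClass_mem_layerFour (q : ℚ) (κ : Fin 5 →₀ ℕ) (β₀ β₁ β₂ γ₁ γ₂ γ₃ α₀₂ α₀₃ α₁₃ : ℕ) (s : KZ.IntegralRep 4)
    (hd : s.domain = KZ.openOrderedSimplex 4)
    (hi : EqOn s.integrand (fun t => (q : ℝ) * gapF4 κ β₀ β₁ β₂ γ₁ γ₂ γ₃ α₀₂ α₀₃ α₁₃ t) s.domain) :
    CongInto (layerFour ∪ gzLT 4) (KZ.of s) := by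
  refine congInto_self (Or.inl ⟨s, ⟨hd, q, κ 0, κ 1, κ 2, κ 3, κ 4, β₀, β₁, β₂, γ₁, γ₂, γ₃, α₀₂, α₀₃, α₁₃, fun t ht => ?_⟩, rfl⟩)
  rw [hi ht]
  simp only [gapF4]
  ring

/-! ### §M4 MATCH₄ from its three stubs, and the refined (A₄) frame -/

/-- **MATCH₄ ⟸ N₄ ∧ E₄ ∧ S₄** (all glue proved): -/
theorem match_four_of (hN : OrdersFour) (hE : GapFormFour) (hS : GapClassIntegrableFour) :
    ∀ r : KZ.IntegralRep 4, IsReducedFour r → CongInto (layerFour ∪ gzLT 4) (KZ.of r) := by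
  intro r hr
  obtain ⟨β₀, β₁, β₂, γ₁, γ₂, γ₃, α₀₂, α₀₃, α₁₃, H, hκ, hd, hi⟩ := hE r (hN r hr)
  have key := (sum_pack4 (layerFour ∪ gzLT 4) H.support
    (fun κ t => ((MvPolynomial.coeff κ H : ℚ) : ℝ) * gapF4 κ β₀ β₁ β₂ γ₁ γ₂ γ₃ α₀₂ α₀₃ α₁₃ t)
    (fun κ _ => gapF4_smul_sa _ κ β₀ β₁ β₂ γ₁ γ₂ γ₃ α₀₂ α₀₃ α₁₃)
    (fun κ hκ' => (hS κ β₀ β₁ β₂ γ₁ γ₂ γ₃ α₀₂ α₀₃ α₁₃ (hκ κ hκ')).const_mul _)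
    (fun κ _ s hs hsi => gapClass_mem_layerFour (MvPolynomial.coeff κ H) κ β₀ β₁ β₂ γ₁ γ₂ γ₃ α₀₂ α₀₃ α₁₃ s hs hsi)).2.2
  exact key r hd hi

/-- **(A₄) ⟸ N₄ ∧ E₄ ∧ S₄ ∧ LAYER₄** — the refined frame (S1 `wlog_four` discharged). -/
theorem polarReduction_four_of_stubs (hN : OrdersFour) (hE : GapFormFour) (hS : GapClassIntegrableFour)
    (h₅ : ∀ s : KZ.IntegralRep 4, IsLayerFour s → CongInto (cellGens 4 ∪ gzLT 4) (KZ.of s)) :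
    PolarReduction 4 :=
  polarReduction_four_of (match_four_of hN hE hS) h₅

end Summit.KontsevichZagierPeriods.KontsevichZagierPeriods.Cruxes.GZNormalFormWThree.GZLadder.MatchFour

/-! ## §E  E₄ PROVED: `GapFormFour` (decomp-kz lens-1 g13, RUNG4_sec22 §24)

The algebraic heart of MATCH₄.  THE HOMOGENEOUS GAP EXPANSION IS UNIQUE (`gapSub_injective_of_isHomogeneous`: a degree-`D` form in the
five gap variables vanishing under `y ↦ gaps(X)` is zero — shear `y₀ ↦ y₀ - (y₁+⋯+y₄)`, then dehomogenise `y₀ ↦ 1`, which is injective on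
degree-`D` forms because `κ ↦ (κ₁,…,κ₄)` is injective on `|κ| = D`), and FOR EACH CHART `τ ∈ {id, σ₄, τ₀₁, τ₁₂}` the expansion can be BUILT from
`P∘τ = Σ a_e u^e` as `Σ a_e (Σy)^{D-|e|} ∏ U^τ_j^{e_j}` with the chart coordinates `U^τ_j` INTERVAL SUMS of gap variables; in that construction
every monomial visibly has `G`-weight `≥ min Σ_{j∈I} e_j` for the clusters `G` read in that chart.  By uniqueness the four constructions
coincide, so THE expansion satisfies all nine cluster inequalities: `Admissible4`. -/

namespace Summit.KontsevichZagierPeriods.KontsevichZagierPeriods.Cruxes.GZNormalFormWThree.GZLadder.GapForm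

set_option linter.unusedTactic false
set_option linter.unreachableTactic false

open MvPolynomial Finset Pointwise
open Summit.KontsevichZagierPeriods.KontsevichZagierPeriods.Cruxes.GZNormalFormWThree.GZLadder.RungFour
open Summit.KontsevichZagierPeriods.KontsevichZagierPeriods.Cruxes.GZNormalFormWThree.GZLadder.WlogFour
open Summit.KontsevichZagierPeriods.KontsevichZagierPeriods.Cruxes.GZNormalFormWThree.GZLadder.MatchFour

/-! ### §E1 The gap substitution and its pointwise meaning -/

/-- the five gaps as polynomials in `t`: `(1 - X₀, X₀ - X₁, X₁ - X₂, X₂ - X₃, X₃)` -/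
def gapsP : Fin 5 → MvPolynomial (Fin 4) ℚ := ![C 1 - X 0, X 0 - X 1, X 1 - X 2, X 2 - X 3, X 3]

/-- `R(y₀,…,y₄) ↦ R(gaps(X))` -/
def gapSub : MvPolynomial (Fin 5) ℚ →ₐ[ℚ] MvPolynomial (Fin 4) ℚ := bind₁ gapsP

/-- the five gaps of a point `t ∈ ℝ⁴` -/
def gaps (t : Fin 4 → ℝ) : Fin 5 → ℝ := ![1 - t 0, t 0 - t 1, t 1 - t 2, t 2 - t 3, t 3]

/-- Auxiliary step `gaps_zero` (§E1): gaps zero. [bookkeeping] -/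
@[simp] theorem gaps_zero (t : Fin 4 → ℝ) : gaps t 0 = 1 - t 0 := rfl
/-- Auxiliary step `gaps_one` (§E1): gaps one. [bookkeeping] -/
@[simp] theorem gaps_one (t : Fin 4 → ℝ) : gaps t 1 = t 0 - t 1 := rfl
/-- Auxiliary step `gaps_two` (§E1): gaps two. [bookkeeping] -/
@[simp] theorem gaps_two (t : Fin 4 → ℝ) : gaps t 2 = t 1 - t 2 := rfl
/-- Auxiliary step `gaps_three` (§E1): gaps three. [bookkeeping] -/
@[simp] theorem gaps_three (t : Fin 4 → ℝ) : gaps t 3 = t 2 - t 3 := rfl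
/-- Auxiliary step `gaps_four` (§E1): gaps four. [bookkeeping] -/
@[simp] theorem gaps_four (t : Fin 4 → ℝ) : gaps t 4 = t 3 := rfl

/-- Auxiliary step `aeval_gapSub` (§E1): aeval gap Sub. [bookkeeping] -/
theorem aeval_gapSub (t : Fin 4 → ℝ) (R : MvPolynomial (Fin 5) ℚ) : aeval t (gapSub R) = aeval (gaps t) R := by
  have e : (fun i => aeval t (gapsP i)) = gaps t := by
    funext i
    fin_cases i <;> simp [gapsP, gaps]
  rw [gapSub, aeval_bind₁, e]

/-- evaluation of a gap polynomial as an explicit sum of monomials -/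
theorem aeval_gaps_eq_sum (t : Fin 4 → ℝ) (R : MvPolynomial (Fin 5) ℚ) :
    aeval (gaps t) R = ∑ κ ∈ R.support, ((coeff κ R : ℚ) : ℝ) * ∏ i, gaps t i ^ κ i := by
  rw [MvPolynomial.aeval_def, MvPolynomial.eval₂_eq']
  simp only [eq_ratCast]

/-- Auxiliary step `gapSub_sumX` (§E1): gap Sub sum X. [bookkeeping] -/
theorem gapSub_sumX : gapSub (∑ i : Fin 5, X i) = 1 := by
  simp only [gapSub, map_sum, bind₁_X_right, Fin.sum_univ_five]
  simp [gapsP]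

/-! ### §E2 Uniqueness of the homogeneous gap expansion -/

/-- substitution of LINEAR FORMS preserves homogeneity -/
theorem isHomogeneous_bind₁_linear {σ : Type*} (f : Fin 5 → MvPolynomial σ ℚ) (hf : ∀ i, (f i).IsHomogeneous 1)
    {R : MvPolynomial (Fin 5) ℚ} {d : ℕ} (hR : R.IsHomogeneous d) : (bind₁ f R).IsHomogeneous d := by
  classical
  rw [R.as_sum, map_sum]
  refine IsHomogeneous.sum _ _ _ fun κ hκ => ?_
  rw [bind₁_monomial]
  have h := (IsHomogeneous.prod κ.support (fun i => f i ^ κ i) (fun i => 1 * κ i) fun i _ => (hf i).pow (κ i)).C_mul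
    (coeff κ R)
  have hd : ∑ i ∈ κ.support, 1 * κ i = d := by
    have := hR (mem_support_iff.mp hκ)
    simpa [Finsupp.weight_apply, Finsupp.sum] using this
  rwa [hd] at h

/-- the shear `y₀ ↦ y₀ - (y₁+y₂+y₃+y₄)` -/
def shearV : Fin 5 → MvPolynomial (Fin 5) ℚ := ![X 0 - (X 1 + X 2 + X 3 + X 4), X 1, X 2, X 3, X 4]
/-- its inverse `y₀ ↦ y₀ + (y₁+y₂+y₃+y₄)` -/
def unshearV : Fin 5 → MvPolynomial (Fin 5) ℚ := ![X 0 + (X 1 + X 2 + X 3 + X 4), X 1, X 2, X 3, X 4]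
/-- dehomogenisation `y₀ ↦ 1`, `yᵢ ↦ Xᵢ₋₁` -/
def dhV : Fin 5 → MvPolynomial (Fin 4) ℚ := ![1, X 0, X 1, X 2, X 3]
/-- `t_j = y_{j+1} + ⋯ + y₄` in the last four gap variables renamed `X₀..X₃` -/
def tailP : Fin 4 → MvPolynomial (Fin 4) ℚ := ![X 0 + X 1 + X 2 + X 3, X 1 + X 2 + X 3, X 2 + X 3, X 3]

/-- Auxiliary step `unshear_shear` (§E2): unshear shear. [bookkeeping] -/
theorem unshear_shear : (bind₁ unshearV).comp (bind₁ shearV) = AlgHom.id ℚ (MvPolynomial (Fin 5) ℚ) :=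
  MvPolynomial.algHom_ext fun i => by
    fin_cases i <;> simp [shearV, unshearV, bind₁_X_right]

/-- Auxiliary step `dh_shear` (§E2): dh shear. [bookkeeping] -/
theorem dh_shear : (bind₁ dhV).comp (bind₁ shearV) = (bind₁ tailP).comp gapSub :=
  MvPolynomial.algHom_ext fun i => by
    fin_cases i <;> simp [shearV, dhV, tailP, gapSub, gapsP, bind₁_X_right] <;> ring

/-- Auxiliary step `shearV_isHomogeneous` (§E2): shear V is Homogeneous. [bookkeeping] -/
theorem shearV_isHomogeneous : ∀ i, (shearV i).IsHomogeneous 1 := by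
  intro i
  fin_cases i
  · exact (isHomogeneous_X ℚ 0).sub
      ((((isHomogeneous_X ℚ 1).add (isHomogeneous_X ℚ 2)).add (isHomogeneous_X ℚ 3)).add (isHomogeneous_X ℚ 4))
  · exact isHomogeneous_X ℚ 1
  · exact isHomogeneous_X ℚ 2
  · exact isHomogeneous_X ℚ 3
  · exact isHomogeneous_X ℚ 4

/-- forgetting the `y₀`-exponent -/
def tl (μ : Fin 5 →₀ ℕ) : Fin 4 →₀ ℕ := Finsupp.equivFunOnFinite.symm ![μ 1, μ 2, μ 3, μ 4]

/-- Auxiliary step `tl_zero` (§E2): tl zero. [bookkeeping] -/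
@[simp] theorem tl_zero (μ : Fin 5 →₀ ℕ) : tl μ 0 = μ 1 := by simp [tl]
/-- Auxiliary step `tl_one` (§E2): tl one. [bookkeeping] -/
@[simp] theorem tl_one (μ : Fin 5 →₀ ℕ) : tl μ 1 = μ 2 := by simp [tl]
/-- Auxiliary step `tl_two` (§E2): tl two. [bookkeeping] -/
@[simp] theorem tl_two (μ : Fin 5 →₀ ℕ) : tl μ 2 = μ 3 := by simp [tl]
/-- Auxiliary step `tl_three` (§E2): tl three. [bookkeeping] -/
@[simp] theorem tl_three (μ : Fin 5 →₀ ℕ) : tl μ 3 = μ 4 := by simp [tl]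

/-- Auxiliary step `bind₁_dhV_monomial` (§E2): bind₁ dh V monomial. [bookkeeping] -/
theorem bind₁_dhV_monomial (μ : Fin 5 →₀ ℕ) (c : ℚ) : bind₁ dhV (monomial μ c) = monomial (tl μ) c := by
  rw [bind₁_monomial, monomial_eq, Finsupp.prod_pow,
    Finset.prod_subset (Finset.subset_univ μ.support) (fun i _ hi => by
      rw [Finsupp.mem_support_iff, not_not] at hi
      rw [hi, pow_zero])]
  simp [Fin.prod_univ_five, Fin.prod_univ_four, dhV]

/-- Auxiliary step `sum_eq_of_isHomogeneous` (§E2): sum eq of is Homogeneous. [bookkeeping] -/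
theorem sum_eq_of_isHomogeneous {R : MvPolynomial (Fin 5) ℚ} {d : ℕ} (hR : R.IsHomogeneous d) {κ : Fin 5 →₀ ℕ}
    (hκ : coeff κ R ≠ 0) : κ 0 + κ 1 + κ 2 + κ 3 + κ 4 = d := by
  have h := hR hκ
  simpa [Finsupp.weight_apply, Finsupp.sum_fintype, Fin.sum_univ_five] using h

/-- Auxiliary step `coeff_tl_bind₁_dhV` (§E2): coeff tl bind₁ dh V. [bookkeeping] -/
theorem coeff_tl_bind₁_dhV {R : MvPolynomial (Fin 5) ℚ} {d : ℕ} (hR : R.IsHomogeneous d) {κ : Fin 5 →₀ ℕ}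
    (hκ : κ 0 + κ 1 + κ 2 + κ 3 + κ 4 = d) : coeff (tl κ) (bind₁ dhV R) = coeff κ R := by
  classical
  conv_lhs => rw [R.as_sum, map_sum]
  simp only [bind₁_dhV_monomial, coeff_sum, coeff_monomial]
  rw [Finset.sum_eq_single κ]
  · rw [if_pos rfl]
  · intro μ hμ hμκ
    rw [if_neg]
    intro htl
    apply hμκ
    have hμd := sum_eq_of_isHomogeneous hR (mem_support_iff.mp hμ)
    have e1 : μ 1 = κ 1 := by simpa using DFunLike.congr_fun htl 0
    have e2 : μ 2 = κ 2 := by simpa using DFunLike.congr_fun htl 1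
    have e3 : μ 3 = κ 3 := by simpa using DFunLike.congr_fun htl 2
    have e4 : μ 4 = κ 4 := by simpa using DFunLike.congr_fun htl 3
    have e0 : μ 0 = κ 0 := by omega
    ext i
    fin_cases i
    · exact e0
    · exact e1
    · exact e2
    · exact e3
    · exact e4
  · intro hκ'
    rw [if_pos rfl]
    simpa [mem_support_iff] using hκ'

/-- Auxiliary step `eq_zero_of_bind₁_dhV` (§E2): eq zero of bind₁ dh V. [bookkeeping] -/
theorem eq_zero_of_bind₁_dhV {R : MvPolynomial (Fin 5) ℚ} {d : ℕ} (hR : R.IsHomogeneous d) (h : bind₁ dhV R = 0) :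
    R = 0 := by
  ext κ
  rw [coeff_zero]
  by_contra hne
  have h2 := coeff_tl_bind₁_dhV hR (sum_eq_of_isHomogeneous hR hne)
  rw [h, coeff_zero] at h2
  exact hne h2.symm

/-- **UNIQUENESS OF THE HOMOGENEOUS GAP EXPANSION**: a degree-`d` form in the gap variables that vanishes under `y ↦ gaps(X)` is zero. -/
theorem gapSub_injective_of_isHomogeneous {R : MvPolynomial (Fin 5) ℚ} {d : ℕ} (hR : R.IsHomogeneous d)
    (h0 : gapSub R = 0) : R = 0 := by
  have hR₁ : (bind₁ shearV R).IsHomogeneous d := isHomogeneous_bind₁_linear shearV shearV_isHomogeneous hR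
  have h1 : bind₁ dhV (bind₁ shearV R) = 0 := by
    have e := AlgHom.congr_fun dh_shear R
    simp only [AlgHom.comp_apply] at e
    rw [e, h0, map_zero]
  have h2 := eq_zero_of_bind₁_dhV hR₁ h1
  have e := AlgHom.congr_fun unshear_shear R
  simp only [AlgHom.comp_apply, AlgHom.id_apply] at e
  rw [← e, h2, map_zero]

/-- Auxiliary step `eq_of_gapSub_eq` (§E2): eq of gap Sub eq. [bookkeeping] -/
theorem eq_of_gapSub_eq {A B : MvPolynomial (Fin 5) ℚ} {d : ℕ} (hA : A.IsHomogeneous d) (hB : B.IsHomogeneous d)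
    (h : gapSub A = gapSub B) : A = B :=
  sub_eq_zero.mp (gapSub_injective_of_isHomogeneous (hA.sub hB) (by rw [map_sub, h, sub_self]))

/-! ### §E3 Weight orders along a cluster -/

/-- the `G`-weight `deg_G κ = Σ_{i ∈ G} κᵢ` of a gap monomial -/
def wdeg (G : Finset (Fin 5)) (κ : Fin 5 →₀ ℕ) : ℕ := ∑ i ∈ G, κ i

/-- Auxiliary step `wdeg_add` (§E3): wdeg add. [bookkeeping] -/
theorem wdeg_add (G : Finset (Fin 5)) (a b : Fin 5 →₀ ℕ) : wdeg G (a + b) = wdeg G a + wdeg G b := by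
  simp [wdeg, Finset.sum_add_distrib]

/-- every monomial of `A` has `G`-weight `≥ m` -/
def WOrd (G : Finset (Fin 5)) (m : ℕ) (A : MvPolynomial (Fin 5) ℚ) : Prop := ∀ κ ∈ A.support, m ≤ wdeg G κ

/-- Auxiliary step `wOrd_zero_left` (§E3): w Ord zero left. [bookkeeping] -/
theorem wOrd_zero_left (G : Finset (Fin 5)) (A : MvPolynomial (Fin 5) ℚ) : WOrd G 0 A := fun _ _ => Nat.zero_le _

/-- Auxiliary step `wOrd_zero` (§E3): w Ord zero. [bookkeeping] -/
theorem wOrd_zero (G : Finset (Fin 5)) (m : ℕ) : WOrd G m (0 : MvPolynomial (Fin 5) ℚ) := fun κ hκ => by simp at hκ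

/-- Auxiliary step `mono` (§E3): mono. [bookkeeping] -/
theorem WOrd.mono {G : Finset (Fin 5)} {m n : ℕ} {A : MvPolynomial (Fin 5) ℚ} (h : WOrd G n A) (hmn : m ≤ n) :
    WOrd G m A := fun κ hκ => hmn.trans (h κ hκ)

/-- Auxiliary step `add` (§E3): add. [bookkeeping] -/
theorem WOrd.add {G : Finset (Fin 5)} {m : ℕ} {A B : MvPolynomial (Fin 5) ℚ} (hA : WOrd G m A) (hB : WOrd G m B) :
    WOrd G m (A + B) := by
  intro κ hκ
  rcases Finset.mem_union.mp (support_add hκ) with h | h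
  exacts [hA κ h, hB κ h]

/-- Auxiliary step `neg` (§E3): neg. [bookkeeping] -/
theorem WOrd.neg {G : Finset (Fin 5)} {m : ℕ} {A : MvPolynomial (Fin 5) ℚ} (hA : WOrd G m A) : WOrd G m (-A) :=
  fun κ hκ => hA κ (by rwa [support_neg] at hκ)

/-- Auxiliary step `sub` (§E3): sub. [bookkeeping] -/
theorem WOrd.sub {G : Finset (Fin 5)} {m : ℕ} {A B : MvPolynomial (Fin 5) ℚ} (hA : WOrd G m A) (hB : WOrd G m B) :
    WOrd G m (A - B) := by
  rw [sub_eq_add_neg]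
  exact hA.add hB.neg

/-- Auxiliary step `mul` (§E3): mul. [bookkeeping] -/
theorem WOrd.mul {G : Finset (Fin 5)} {m n : ℕ} {A B : MvPolynomial (Fin 5) ℚ} (hA : WOrd G m A) (hB : WOrd G n B) :
    WOrd G (m + n) (A * B) := by
  intro κ hκ
  obtain ⟨a, ha, b, hb, rfl⟩ := Finset.mem_add.mp (support_mul A B hκ)
  rw [wdeg_add]
  exact Nat.add_le_add (hA a ha) (hB b hb)

/-- Auxiliary step `pow` (§E3): pow. [bookkeeping] -/
theorem WOrd.pow {G : Finset (Fin 5)} {m : ℕ} {A : MvPolynomial (Fin 5) ℚ} (hA : WOrd G m A) (n : ℕ) :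
    WOrd G (m * n) (A ^ n) := by
  induction n with
  | zero => simpa using wOrd_zero_left G (1 : MvPolynomial (Fin 5) ℚ)
  | succ n ih =>
    rw [pow_succ, Nat.mul_succ]
    exact ih.mul hA

/-- Auxiliary step `sum` (§E3): sum. [bookkeeping] -/
theorem WOrd.sum {G : Finset (Fin 5)} {m : ℕ} {ι : Type*} (s : Finset ι) (f : ι → MvPolynomial (Fin 5) ℚ)
    (h : ∀ i ∈ s, WOrd G m (f i)) : WOrd G m (∑ i ∈ s, f i) := by
  classical
  induction s using Finset.induction_on with
  | empty => simpa using wOrd_zero G m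
  | insert a s ha ih =>
    rw [Finset.sum_insert ha]
    exact (h a (Finset.mem_insert_self a s)).add (ih fun i hi => h i (Finset.mem_insert_of_mem hi))

end Summit.KontsevichZagierPeriods.KontsevichZagierPeriods.Cruxes.GZNormalFormWThree.GZLadder.GapForm
end
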